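import Literature.AnabelianGeometry.SemiGraphs.ProSigmaCompletionModels
import Mathlib.Algebra.Group.PUnit
import HarnessLib

/-!
# [SemiAnbd] Ex. 2.10 interface `IsProSigmaCompletion` as a FACT-LIST row (F-2528): kernel closure census

Mochizuki, *Semi-graphs of anabelioids*, Publ. RIMS **42** (2006), Example 2.10 p. 31 ("the maximal
pro-`Σ` quotient of the fundamental group of a hyperbolic Riemann surface") [cite: MochizukiSemiAnbd2006,
Ex. 2.10 p.31].  abc-iut cell, D-0078 fact-proving wave, row F-2528 of tranche 161 (`plan/F-TRANCHES.tsv`;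
seat abc-iut-w5-d095, gen 4); PROOF-ONLY companion of `Coverticial.lean` (abc-iut-L3-t1: the structure
`SemiGraphOfAnabelioids.IsProSigmaCompletion Sigma ι` — dense image, open normal subgroups of `Σ`-integer
index, finite `Σ`-quotients of `Γ` cut out by open subgroups of `P`) and of abc-iut-L3's model file
`ProSigmaCompletionModels.lean`.  No definition is introduced or restated.

WHAT IS RECORDED.  F-2528 is an INTERFACE PREDICATE on a homomorphism `ι : Γ → P`, not a theorem:

* `not_isProSigmaCompletion_of_subsingleton` — no homomorphism into a TRIVIAL group is a pro-`Σ`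
  completion of a group possessing a proper normal subgroup of `Σ`-integer index (the universality clause
  `comap_surj` fails: every open `U ≤ P` pulls back to all of `Γ`);
* `not_isProSigmaCompletion_zmodTwo_punit` — in particular `ℤ/2 → 1` is not a pro-`Σ` completion for
  `Σ = {all primes}`; hence the UNIVERSAL CLOSURE of F-2528 is FALSE (`not_forall_isProSigmaCompletion`);
* the predicate is INHABITED by the genuine model already in the tree —
  `IsProSigmaCompletion.isProSigmaCompletion_toCompletion G : IsProSigmaCompletion {p | p.Prime} (toCompletion G)`
  (Mathlib's profinite completion; cited by name, `exists_isProSigmaCompletion`).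

FACT-LIST reading: F-2528 = «structure / interface predicate; universal closure REFUTED; instance PROVED
(profinite completion model)».  Classical; no side taken on [IUTchIII] Cor. 3.12; a FACT row is an
assumption label; typed ≠ proved.
-/

namespace Literature.AnabelianGeometry.SemiGraphs.SemiGraphOfAnabelioids

open Literature.AnabelianGeometry.Anabelioids Literature.IUT.HodgeTheaters

/-- No homomorphism into a trivial group is a pro-`Σ` completion of a group `Γ` having a PROPER normal
subgroup `N` of `Σ`-integer index: the clause "finite `Σ`-quotients of `Γ` factor through `P`" would
give an open `U ≤ P` with `ι⁻¹(U) = N`, but `ι⁻¹(U) = Γ`. [cite: MochizukiSemiAnbd2006, Ex. 2.10 p.31] -/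
theorem not_isProSigmaCompletion_of_subsingleton {Sigma : Set ℕ} {Γ : Type*} [Group Γ] {P : Type*}
    [Group P] [TopologicalSpace P] [Subsingleton P] (ι : Γ →* P) (N : Subgroup Γ) [N.Normal]
    (hN : N ≠ ⊤) (hσ : IsSigmaInteger Sigma N.index) : ¬ IsProSigmaCompletion Sigma ι := by
  intro h
  obtain ⟨U, -, hU⟩ := h.comap_surj N inferInstance hσ
  apply hN
  rw [← hU, eq_top_iff]
  intro x _
  simp only [Subgroup.mem_comap]
  rw [Subsingleton.elim (ι x) 1]
  exact U.one_mem

/-- `ℤ/2ℤ → 1` is not a pro-`Σ` completion for `Σ = {all primes}` (`⊥ ⊴ ℤ/2ℤ` is proper of index `2`).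
[cite: MochizukiSemiAnbd2006, Ex. 2.10 p.31] -/
theorem not_isProSigmaCompletion_zmodTwo_punit :
    ¬ IsProSigmaCompletion {p : ℕ | p.Prime} (1 : Multiplicative (ZMod 2) →* PUnit.{1}) := by
  refine not_isProSigmaCompletion_of_subsingleton _ ⊥ ?_ ?_
  · intro h
    have : (Multiplicative.ofAdd (1 : ZMod 2)) ∈ (⊥ : Subgroup (Multiplicative (ZMod 2))) := by
      rw [h]; trivial
    exact absurd (Subgroup.mem_bot.mp this) (by decide)
  · refine ⟨?_, fun p hp _ => hp⟩
    rw [Subgroup.index_bot, Nat.card_eq_fintype_card, Fintype.card_multiplicative, ZMod.card]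
    decide

/-- **F-2528 is an interface predicate: its universal closure is FALSE.**
[cite: MochizukiSemiAnbd2006, Ex. 2.10 p.31] -/
theorem not_forall_isProSigmaCompletion :
    ¬ ∀ (Sigma : Set ℕ) (Γ : Type) (_ : Group Γ) (P : Type) (_ : Group P) (_ : TopologicalSpace P)
        (ι : Γ →* P), IsProSigmaCompletion Sigma ι :=
  fun h => not_isProSigmaCompletion_zmodTwo_punit (h _ _ _ _ _ _ _)

/-- … and it is INHABITED by the genuine model: the profinite completion of any group is a pro-`Σ`
completion for `Σ = {all primes}` (abc-iut-L3's `isProSigmaCompletion_toCompletion`, cited).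
[cite: MochizukiSemiAnbd2006, Ex. 2.10 p.31] -/
theorem exists_isProSigmaCompletion (G : Type) [Group G] :
    ∃ (P : Type) (_ : Group P) (_ : TopologicalSpace P) (ι : G →* P),
      IsProSigmaCompletion {p : ℕ | p.Prime} ι :=
  ⟨_, _, _, toCompletion G, IsProSigmaCompletion.isProSigmaCompletion_toCompletion G⟩

end Literature.AnabelianGeometry.SemiGraphs.SemiGraphOfAnabelioids
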